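import Summits.ABC.ABC.Theses.DefiniteXi
import Literature.NumberTheory.EllipticCurves.TakahashiDegreeFormula
import Literature.NumberTheory.EllipticCurves.ModularCurveManinSemistableProofs
import Literature.NumberTheory.EllipticCurves.ModularCurveManinSemistableBridgeProofs
import Literature.NumberTheory.EllipticCurves.CuspFormLFunctionLevelConductorProofs
import Literature.NumberTheory.Automorphic.ShimuraCurveRibetTakahashiComponentOrders
import Literature.NumberTheory.EllipticCurves.AnalyticIsogenyDescentProofs
import Literature.NumberTheory.EllipticCurves.IsogenyDegreeLatticeIndexProofs
import Literature.NumberTheory.EllipticCurves.LatticeInclusionIsogenyDegreeProofs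
import Literature.NumberTheory.EllipticCurves.PastenSpectralDegreeIsogenyBoundProofs
import Literature.NumberTheory.EllipticCurves.PastenHeightBoundsLemma68Proofs
import Literature.NumberTheory.DiophantineGeometry.GeneralizedFermatTwoPowerCoefficientFreyProofs
import Literature.NumberTheory.DiophantineGeometry.GeneralizedFermatTwoPowerCoefficientSerreProofs
import Literature.NumberTheory.DiophantineGeometry.MinimalDiscriminantFactorizationProofs
import Literature.NumberTheory.DiophantineGeometry.ConductorRadicalProofs
import Literature.NumberTheory.EllipticCurves.IsogenyDualInseparableProofs
import Literature.NumberTheory.EllipticCurves.ModularDegreeMinimal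
import Literature.NumberTheory.EllipticCurves.TakahashiDegreeFormulaCoprimeProofs
import Literature.NumberTheory.Automorphic.BrandtXiSetupIndependence
import Summits.ABC.ABC.Theorems.DefiniteXiDefiniteRTControlPrimeFreyLocal
import Summits.ABC.ABC.Theorems.DefiniteXiFreyModularityIsModular
import HarnessLib

/-!
# stub-ideation k1 GEN 14 — `stub_xiDegreeComparison` (crux `SteinbergCore`, stmt-ABC-15024)
# Sketch: PLAN B PROVED — `PrimeComparison` (child 1 at prime type, `C = 1`) from
# {`takahashi2001_thm_2_3_of_coprime`, `exists_isNewformOf`}; 0 `sorry`, axioms standard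

Companion of `STUB-IDEAS-stub_xiDegreeComparison-1.md` (gen 14).  Gen 13 (file
`STUB_IDEAS_stub_xiDegreeComparison_1_g13_Sketch.lean`) left ONE `L`-sized helper on the Kenku-free
PLAN B (`C = 1` at prime type): B1 = "analytic descent WITH kernel count"
(`∃ φ : Isogeny W₁ W₂, deg φ = #ker(z ↦ cz)`).  That lemma is ALREADY LANDED (2026-08-28, BSD cell):
`Literature.NumberTheory.EllipticCurves.exists_isogeny_degree_eq_of_isNeronLatticeOf`
(`LatticeInclusionIsogenyDegreeProofs`), whose hypotheses `IsNeronLatticeOf (Wᵢ.baseChange ℂ) Lᵢ` are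
literally the structure field `ModularParametrizationData.isNeronLattice`.  With the tree's degree
formula `modularDegree_eq_card_ker_mul` (optimal raw data := the optimal datum `D₀`), the kernel count
`natCard_ker_mulQuotientMap_eq_relIndex` and an index transport under `z ↦ c₀ z` (H5 below, proved),
gen 13's B2 becomes a THEOREM (Part I, no `sorry`):

  `exists_isogeny_modularDegree_eq : D₀.f = D.f → (D₀ lattice-optimal) →
      ∃ α : Isogeny W₀ W, D.modularDegree = α.degree * D₀.modularDegree`.

Part II PROVES the rest of PLAN B as well: B3 (6-free arithmetic), B4-val (Lemma 6.8 along the isogeny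
`α`, Kenku-free), B4-core (the whole arithmetic, constant ONE) and B4 = `primeComparison_kenkuFree :
takahashi2001_thm_2_3_of_coprime → exists_isNewformOf → FreyModularity → PrimeComparison` — p137891's
`xiDegreeComparison_prime_of_facts` with the optimal pivot `(W₀, D₀)` (conductor `N` by Carayol-via-
modularity), its Mazur–Kenku block and `stub_valTransport` deleted.  Part III: typing checks of the inputs.
-/

set_option linter.dupNamespace false

noncomputable section

namespace Summit.ABC.ABC.Cruxes.SteinbergCore.StubIdeasK1G14

open Summit.ABC.ABC.Theses.DefiniteXi
open Literature.NumberTheory.EllipticCurves Literature.NumberTheory.EllipticCurves.ModularForms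
open Literature.NumberTheory.Automorphic
open WeierstrassCurve

/-! ## Part I — the bridge `deg D = deg α · deg D₀` (PROVED) -/

/-- Pure group theory: the image under `z ↦ bz` (`b ≠ 0`) of `a⁻¹Λ = comap (z ↦ az) Λ` is
`c⁻¹Λ` for `c b = a`. -/
theorem map_mulLeft_comap_mulLeft (Λ : AddSubgroup ℂ) {a b c : ℂ} (hb : b ≠ 0) (h : c * b = a) :
    (Λ.comap (AddMonoidHom.mulLeft a)).map (AddMonoidHom.mulLeft b) =
      Λ.comap (AddMonoidHom.mulLeft c) := by
  subst h
  ext x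
  simp only [AddSubgroup.mem_map, AddSubgroup.mem_comap, AddMonoidHom.coe_mulLeft]
  constructor
  · rintro ⟨z, hz, rfl⟩
    rwa [← mul_assoc]
  · intro hx
    refine ⟨b⁻¹ * x, ?_, by rw [← mul_assoc, mul_inv_cancel₀ hb, one_mul]⟩
    rwa [mul_assoc, ← mul_assoc b, mul_inv_cancel₀ hb, one_mul]

/-- **H5 (index transport).** For a datum `D` of `W` and a LATTICE-OPTIMAL datum `D₀` (`Λ₀ = c₀Λ_f`)
with the same newform `f`, and `c c₀ = c_D`:  `[c_D⁻¹Λ_E : Λ_f] = [c⁻¹Λ_E : Λ₀]`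
(multiplication by `c₀` is an automorphism of `(ℂ,+)` carrying `Λ_f` onto `Λ₀` and `c_D⁻¹Λ_E` onto
`c⁻¹Λ_E`; Mathlib `AddSubgroup.relIndex_map_map_of_injective`). -/
theorem relIndex_periodLattice_eq_relIndex_optimal {N : ℕ} [NeZero N] {W W₀ : WeierstrassCurve ℚ}
    (D : ModularParametrizationData W N) (D₀ : ModularParametrizationData W₀ N)
    (hf : D₀.f = D.f) (h₀ : ∀ z ∈ D₀.L.lattice, ∃ w ∈ periodLattice D₀.f, z = D₀.c * w)
    {c : ℂ} (hcc : c * (D₀.c : ℂ) = (D.c : ℂ)) :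
    (periodLattice D.f).relIndex
        (D.L.lattice.toAddSubgroup.comap (AddMonoidHom.mulLeft (D.c : ℂ))) =
      D₀.L.lattice.toAddSubgroup.relIndex
        (D.L.lattice.toAddSubgroup.comap (AddMonoidHom.mulLeft c)) := by
  have hc0 : (D₀.c : ℂ) ≠ 0 := D₀.cast_c_ne_zero
  have hinj : Function.Injective (AddMonoidHom.mulLeft (D₀.c : ℂ) : ℂ →+ ℂ) :=
    mul_right_injective₀ hc0
  have hmapf : (periodLattice D.f).map (AddMonoidHom.mulLeft (D₀.c : ℂ)) =
      D₀.L.lattice.toAddSubgroup := by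
    ext x
    simp only [AddSubgroup.mem_map, AddMonoidHom.coe_mulLeft, Submodule.mem_toAddSubgroup]
    constructor
    · rintro ⟨w, hw, rfl⟩
      have hw' : w ∈ periodLattice D₀.f := by rw [hf]; exact hw
      exact D₀.smul_periodLattice_le w hw'
    · intro hx
      obtain ⟨w, hw, rfl⟩ := h₀ x hx
      have hw' : w ∈ periodLattice D.f := by rw [← hf]; exact hw
      exact ⟨w, hw', rfl⟩
  rw [← AddSubgroup.relIndex_map_map_of_injective (periodLattice D.f)
      (D.L.lattice.toAddSubgroup.comap (AddMonoidHom.mulLeft (D.c : ℂ))) hinj, hmapf,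
    map_mulLeft_comap_mulLeft _ hc0 hcc]

/-- **B2 = gen 13's bridge, now a theorem.** For a datum `D` of `W` (level `N`) and the lattice-optimal
datum `D₀` of `W₀` with the same newform (`exists_optimalDatum'`) there is a `ℚ`-isogeny `α : W₀ → W`
with `deg D = deg α · deg D₀`.  Proof: `deg D = #ker(z ↦ c_D z : ℂ/Λ_f → ℂ/Λ_E) · deg D₀`
(`modularDegree_eq_card_ker_mul` with the optimal datum as raw data), `#ker = [c_D⁻¹Λ_E : Λ_f]`
(`natCard_ker_mulQuotientMap_eq_relIndex`), `= [c⁻¹Λ_E : Λ₀]` for `c := c_D/c₀` (H5), which is the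
degree of the `ℚ`-isogeny of the rational lattice inclusion `cΛ₀ ⊆ Λ_E`
(`exists_isogeny_degree_eq_of_isNeronLatticeOf`, Silverman AEC VI.4.1(b) + III.4.10(c) with descent). -/
theorem exists_isogeny_modularDegree_eq {N : ℕ} [NeZero N] {W W₀ : WeierstrassCurve ℚ}
    [W.IsElliptic] [W₀.IsElliptic] (D : ModularParametrizationData W N)
    (D₀ : ModularParametrizationData W₀ N) (hf : D₀.f = D.f)
    (h₀ : ∀ z ∈ D₀.L.lattice, ∃ w ∈ periodLattice D₀.f, z = D₀.c * w) :
    ∃ α : Isogeny W₀ W, D.modularDegree = α.degree * D₀.modularDegree := by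
  -- (1) `deg D = #ker(z ↦ c_D z) · deg D₀`
  have hinj : Function.Injective D₀.isogenyMap :=
    (AddMonoidHom.ker_eq_bot_iff _).mp (D₀.isogenyMap_ker_eq_bot_iff.mpr h₀)
  obtain ⟨-, hdeg⟩ := D.modularDegree_eq_card_ker_mul hf.symm D₀.smul_periodLattice_le hinj
    D₀.deg_pos D₀.finite_setOf_natCard_fiberOrbits_ne
  -- (2) `#ker = [c_D⁻¹Λ_E : Λ_f]`
  have hker : Nat.card D.isogenyMap.ker =
      (periodLattice D.f).relIndex
        (D.L.lattice.toAddSubgroup.comap (AddMonoidHom.mulLeft (D.c : ℂ))) :=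
    natCard_ker_mulQuotientMap_eq_relIndex
  -- (3) the `ℚ`-isogeny of the inclusion `(c_D/c₀)Λ₀ ⊆ Λ_E`
  have hc0 : (D₀.c : ℂ) ≠ 0 := D₀.cast_c_ne_zero
  set c : ℚ := (D.c : ℚ) / (D₀.c : ℚ) with hc_def
  have hcast : ((c : ℚ) : ℂ) = (D.c : ℂ) / (D₀.c : ℂ) := by
    simp only [hc_def, Rat.cast_div, Rat.cast_intCast]
  have hcc : (c : ℂ) * (D₀.c : ℂ) = (D.c : ℂ) := by
    rw [hcast]
    calc (D.c : ℂ) / (D₀.c : ℂ) * (D₀.c : ℂ) = (D.c : ℂ) * ((D₀.c : ℂ) / (D₀.c : ℂ)) := by ring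
      _ = (D.c : ℂ) := by rw [div_self hc0, mul_one]
  have hc : c ≠ 0 := by
    intro h
    have h' : (D.c : ℂ) = 0 := by rw [← hcc, h, Rat.cast_zero, zero_mul]
    exact D.cast_c_ne_zero h'
  have hle : ∀ z ∈ D₀.L.lattice, (c : ℂ) * z ∈ D.L.lattice := by
    intro z hz
    obtain ⟨w, hw, rfl⟩ := h₀ z hz
    have hw' : w ∈ periodLattice D.f := by rw [← hf]; exact hw
    rw [← mul_assoc, hcc]
    exact D.smul_periodLattice_le w hw'
  obtain ⟨α, hα⟩ := exists_isogeny_degree_eq_of_isNeronLatticeOf W₀ W D₀.isNeronLattice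
    D.isNeronLattice hc hle
  -- (4) assemble
  refine ⟨α, ?_⟩
  rw [hdeg, hker, relIndex_periodLattice_eq_relIndex_optimal D D₀ hf h₀ hcc, ← hα]
  rfl

/-- **B2, packaged with the optimal datum** (`exists_optimalDatum'`): every datum `D` of an elliptic
`W/ℚ` factors, in degree, through an optimal quotient: `∃ W₀ D₀ α, D₀.f = D.f ∧ D₀ optimal ∧
deg D = deg α · deg D₀`. -/
theorem exists_optimal_isogeny_modularDegree_eq {N : ℕ} [NeZero N] {W : WeierstrassCurve ℚ}
    [W.IsElliptic] (D : ModularParametrizationData W N) :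
    ∃ (W₀ : WeierstrassCurve ℚ) (_ : W₀.IsElliptic) (D₀ : ModularParametrizationData W₀ N)
      (α : Isogeny W₀ W), D₀.f = D.f ∧
      (∀ z ∈ D₀.L.lattice, ∃ w ∈ periodLattice D₀.f, z = D₀.c * w) ∧
      D.modularDegree = α.degree * D₀.modularDegree := by
  obtain ⟨W₀, hW₀, D₀, hf, h₀⟩ := D.exists_optimalDatum'
  haveI := hW₀
  obtain ⟨α, hα⟩ := exists_isogeny_modularDegree_eq D D₀ hf h₀
  exact ⟨W₀, hW₀, D₀, α, hf, h₀, hα⟩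

/-! ## Part II — 6-free arithmetic, Lemma 6.8 along `α`, and the prime-type assembly (ALL PROVED) -/

/-- The target at PRIME TYPE = the binder `hC` of `SteinbergCorePrimeRung.primeRung_of_subs_frey`
(p162616) = the conclusion of `xiDegreeComparison_prime_of_facts` (p137891); verbatim gen 13. -/
def PrimeComparison : Prop :=
  ∀ ε : ℝ, 0 < ε → ∃ C : ℝ, ∀ a b : ℤ, IsCoprime a b → a * b * (a + b) ≠ 0 → ∀ (N : ℕ) [NeZero N],
    (freyCurve a b).conductorNorm ℤ = N → ∀ q : ℕ, q.Prime → q ≠ 2 → q ∣ N →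
    brandtXi (N / q) q (fun n => (freyCurve a b).LFunction n) ≠ 0 →
    ∃ D : ModularParametrizationData (freyCurve a b) N,
      (∀ D' : ModularParametrizationData (freyCurve a b) N, D.deg ≤ D'.deg) ∧
      ((brandtXi (N / q) q (fun n => (freyCurve a b).LFunction n) /
          (ordProj[2] (brandtXi (N / q) q (fun n => (freyCurve a b).LFunction n)) *
            ordProj[3] (brandtXi (N / q) q (fun n => (freyCurve a b).LFunction n))) : ℕ) : ℝ) ≤
        C * (N : ℝ) ^ ε * ((D.deg / (ordProj[2] D.deg * ordProj[3] D.deg) : ℕ) : ℝ) *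
          ((∏ p ∈ N.primeFactors, ((freyCurve a b).minimalDiscriminantNorm ℤ).factorization p : ℕ) : ℝ) ^ 3

/-! ### The prime-to-6 projection `cps n = n / (2^{v₂ n} 3^{v₃ n})` — VERBATIM copies of
`Theorems/SteinbergCore/Negative/SteinbergCoreDomain.lean` §A (p-landed; that module's farm snapshot is
unbuilt today, so the light Sketch re-proves the five lines it needs; the stub prover imports the originals
`Summit.ABC.ABC.Theorems.SteinbergCore.Negative.primeToSix_*` and
`Summit.ABC.ABC.Theorems.XiDegreeComparison.primeToSix_le_of_dvd`). -/
namespace Cps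

theorem sixPart_dvd (n : ℕ) : ordProj[2] n * ordProj[3] n ∣ n := by
  rcases Nat.eq_zero_or_pos n with rfl | _
  · exact dvd_zero _
  · exact Nat.Coprime.mul_dvd_of_dvd_of_dvd
      (Nat.Coprime.pow _ _ (by norm_num : Nat.Coprime 2 3)) (Nat.ordProj_dvd n 2) (Nat.ordProj_dvd n 3)

theorem sixPart_pos (n : ℕ) : 0 < ordProj[2] n * ordProj[3] n := by positivity

theorem one_le_primeToSix_iff (n : ℕ) : 1 ≤ n / (ordProj[2] n * ordProj[3] n) ↔ n ≠ 0 := by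
  rw [Nat.succ_le_iff, Nat.div_pos_iff]
  constructor
  · rintro ⟨-, h⟩ rfl
    exact absurd h (not_le.mpr (sixPart_pos 0))
  · intro h
    exact ⟨sixPart_pos n, Nat.le_of_dvd (Nat.pos_of_ne_zero h) (sixPart_dvd n)⟩

theorem primeToSix_le (n : ℕ) : n / (ordProj[2] n * ordProj[3] n) ≤ n := Nat.div_le_self _ _

theorem primeToSix_eq_ordCompl (n : ℕ) :
    n / (ordProj[2] n * ordProj[3] n) = ordCompl[3] (ordCompl[2] n) := by
  have h3 : (ordCompl[2] n).factorization 3 = n.factorization 3 := by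
    rw [Nat.factorization_div (Nat.ordProj_dvd n 2)]
    simp [Nat.prime_two.factorization_pow]
  change n / (ordProj[2] n * ordProj[3] n) = n / ordProj[2] n / 3 ^ (ordCompl[2] n).factorization 3
  rw [h3, Nat.div_div_eq_div_mul]

theorem primeToSix_mul (m n : ℕ) :
    m * n / (ordProj[2] (m * n) * ordProj[3] (m * n)) =
      m / (ordProj[2] m * ordProj[3] m) * (n / (ordProj[2] n * ordProj[3] n)) := by
  rw [primeToSix_eq_ordCompl, primeToSix_eq_ordCompl, primeToSix_eq_ordCompl, Nat.ordCompl_mul,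
    Nat.ordCompl_mul]

theorem primeToSix_le_primeToSix_mul {m n : ℕ} (hn : n ≠ 0) :
    m / (ordProj[2] m * ordProj[3] m) ≤ m * n / (ordProj[2] (m * n) * ordProj[3] (m * n)) := by
  rw [primeToSix_mul]
  exact Nat.le_mul_of_pos_right _ ((one_le_primeToSix_iff n).mpr hn)

theorem primeToSix_le_of_dvd {m n : ℕ} (h : m ∣ n) (hn : n ≠ 0) :
    m / (ordProj[2] m * ordProj[3] m) ≤ n / (ordProj[2] n * ordProj[3] n) := by
  obtain ⟨k, rfl⟩ := h
  exact primeToSix_le_primeToSix_mul (right_ne_zero_of_mul hn)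

end Cps

/-- **B3 (6-free arithmetic) — PROVED.** From `ξ j² b = δ a c` with `j, b ≥ 1`, `a ∣ m`, `m ≥ 1`:
`cps ξ ≤ cps (δ m) · c`:  `cps ξ ≤ cps (ξ j² b) = cps (δ a c) = cps (δ a) cps c ≤ cps (δ m) · c`
(`cps` multiplicative, monotone along divisibility off `0`, `cps c ≤ c`; `ξ = 0` is the junk case). -/
theorem primeToSix_le_of_sq_chain {ξ j b δ a c m : ℕ} (h : ξ * j * j * b = δ * a * c)
    (hj : 0 < j) (hb : 0 < b) (ham : a ∣ m) (hm : 0 < m) :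
    ξ / (ordProj[2] ξ * ordProj[3] ξ) ≤ δ * m / (ordProj[2] (δ * m) * ordProj[3] (δ * m)) * c := by
  rcases Nat.eq_zero_or_pos ξ with hξ | hξ
  · simp [hξ]
  have hprod : δ * a * c ≠ 0 := by rw [← h]; positivity
  have hδ : δ ≠ 0 := fun h0 => hprod (by simp [h0])
  have hjjb : j * j * b ≠ 0 := by positivity
  calc ξ / (ordProj[2] ξ * ordProj[3] ξ)
      ≤ ξ * (j * j * b) / (ordProj[2] (ξ * (j * j * b)) * ordProj[3] (ξ * (j * j * b))) :=
        Cps.primeToSix_le_primeToSix_mul hjjb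
    _ = δ * a * c / (ordProj[2] (δ * a * c) * ordProj[3] (δ * a * c)) := by
        rw [show ξ * (j * j * b) = δ * a * c by rw [← h]; ring]
    _ = δ * a / (ordProj[2] (δ * a) * ordProj[3] (δ * a)) * (c / (ordProj[2] c * ordProj[3] c)) :=
        Cps.primeToSix_mul (δ * a) c
    _ ≤ δ * m / (ordProj[2] (δ * m) * ordProj[3] (δ * m)) * c :=
        Nat.mul_le_mul (Cps.primeToSix_le_of_dvd (mul_dvd_mul_left δ ham) (mul_ne_zero hδ hm.ne'))
          (Cps.primeToSix_le c)

/-- **B4-val (Kenku-free valuation transport along a GIVEN isogeny) — PROVED.** For coprime `a, b`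
(`ab(a+b) ≠ 0`), an odd prime `q ∣ N_E` of the Frey model `E`, and a `ℚ`-isogeny `α : W₀ → E`
(`E ~ W₀`): `c_q(W₀) · b' = c_q(E) · a'` with `a', b' ≥ 1`, `a' b' ∣ deg α` — Pasten's Lemma 6.8 in its
PROVED isogeny form `exists_ordMinimalDiscriminant_mul_eq_mul_of_degree_eq` (`E` is multiplicative at `q`:
`hasMultiplicativeReductionAt_freyCurve_of_ne_two`; so is `W₀`: `hasMultiplicativeReductionAt_of_isIsogenous`),
read on `|Δ_min|` through `factorization_minimalDiscriminantNorm_holds`.  Replaces p137891's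
`stub_valTransport` (`c_q(W') ≤ 163 c_q(E)`, Mazur–Kenku). [cite: PastenShimura2024, Lemma 6.8 (p. 22)] -/
theorem valTransport_isogeny (a b : ℤ) (hab : IsCoprime a b) (h0 : a * b * (a + b) ≠ 0)
    (q : ℕ) (hq : q.Prime) (hq2 : q ≠ 2) (hqN : q ∣ (freyCurve a b).conductorNorm ℤ)
    {W₀ : WeierstrassCurve ℚ} [W₀.IsElliptic] (hiso : (freyCurve a b).IsIsogenous W₀)
    (α : Isogeny W₀ (freyCurve a b)) :
    ∃ a' b' : ℕ, 0 < a' ∧ 0 < b' ∧ a' * b' ∣ α.degree ∧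
      (W₀.minimalDiscriminantNorm ℤ).factorization q * b' =
        ((freyCurve a b).minimalDiscriminantNorm ℤ).factorization q * a' := by
  haveI := isElliptic_freyCurve h0
  obtain ⟨v, hv⟩ :
      ∃ v : IsDedekindDomain.HeightOneSpectrum ℤ, Rat.HeightOneSpectrum.natGenerator v = q :=
    ⟨(Rat.HeightOneSpectrum.primesEquiv (R := ℤ)).symm ⟨q, hq⟩,
      Rat.natGenerator_primesEquiv_symm ⟨q, hq⟩⟩
  have hdvd : (q : ℤ) ∣ a * b * (a + b) :=
    Literature.NumberTheory.DiophantineGeometry.dvd_of_dvd_conductorNorm_freyCurve hab h0 hq hq2 hqN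
  have hmult : (freyCurve a b).HasMultiplicativeReductionAt v :=
    Literature.NumberTheory.DiophantineGeometry.hasMultiplicativeReductionAt_freyCurve_of_ne_two
      hab h0 v (hv ▸ hq2) (hv ▸ hdvd)
  have hmult₀ : W₀.HasMultiplicativeReductionAt v :=
    hasMultiplicativeReductionAt_of_isIsogenous hiso v hmult
  obtain ⟨a', b', ha', hb', hdvd', h⟩ :=
    exists_ordMinimalDiscriminant_mul_eq_mul_of_degree_eq α.degree α rfl v hmult₀ hmult
  have h1 := factorization_minimalDiscriminantNorm_holds (freyCurve a b) v
  have h2 := factorization_minimalDiscriminantNorm_holds W₀ v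
  rw [hv] at h1 h2
  exact ⟨a', b', ha', hb', hdvd', by rw [h1, h2]; exact h⟩

/-- **B4-core (the whole arithmetic of PLAN B) — PROVED.** Takahashi's coordinates at the optimal
pivot (`0 < i`, `i j = c_q(W₀)`, `δ₀ i = ξ j`, `δ₀ ≥ 1`), Lemma 6.8 along `α` (`c_q(W₀) b' = c_q(E) a'`,
`a' b' ∣ m = deg α`, `a', b' ≥ 1`) and the bridge `deg D = m δ₀` give `cps ξ ≤ cps (deg D) · c_q(E)`
— constant ONE, no `163`. -/
theorem primeToSix_xi_le_of_coordinates {ξ i j δ₀ cW cE a' b' m d : ℕ} (hi : 0 < i)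
    (hij : i * j = cW) (hT : δ₀ * i = ξ * j) (hδ₀ : 0 < δ₀) (h68 : cW * b' = cE * a')
(_ha' : 0 < a') (hb' : 0 < b') (hdvd : a' * b' ∣ m) (hm : 0 < m) (hd : d = m * δ₀) :
    ξ / (ordProj[2] ξ * ordProj[3] ξ) ≤ d / (ordProj[2] d * ordProj[3] d) * cE := by
  have hj : 0 < j := by
    rcases Nat.eq_zero_or_pos j with hj | hj
    · exfalso
      rw [hj, mul_zero] at hT
      exact (Nat.mul_pos hδ₀ hi).ne' hT
    · exact hj
  have hchain : ξ * j * j * b' = δ₀ * a' * cE := by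
    calc ξ * j * j * b' = δ₀ * i * j * b' := by rw [← hT]
      _ = δ₀ * (i * j) * b' := by ring
      _ = δ₀ * (cW * b') := by rw [hij]; ring
      _ = δ₀ * a' * cE := by rw [h68]; ring
  have ham : a' ∣ m := (dvd_mul_right a' b').trans hdvd
  rw [hd, mul_comm m δ₀]
  exact primeToSix_le_of_sq_chain hchain hj hb' ham hm

/-- **Passage to `ℝ` with constant `1`** (p137891's `cast_le_of_chain` has `4·163²` hard-wired):
`x ≤ y T ⟹ x ≤ 1 · N^ε · y · T³` for `N ≥ 1`, `T ≥ 1`, `ε > 0`. PROVED. -/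
theorem cast_le_of_chain_one {x y T N : ℕ} {ε : ℝ} (hε : 0 < ε) (hN : N ≠ 0) (hT : 1 ≤ T)
    (h : x ≤ y * T) :
    (x : ℝ) ≤ 1 * (N : ℝ) ^ ε * (y : ℝ) * (T : ℝ) ^ 3 := by
  have hN1 : (1 : ℝ) ≤ (N : ℝ) := by exact_mod_cast Nat.one_le_iff_ne_zero.mpr hN
  have hrpow : (1 : ℝ) ≤ (N : ℝ) ^ ε := Real.one_le_rpow hN1 hε.le
  have hT1 : (1 : ℝ) ≤ (T : ℝ) := by exact_mod_cast hT
  have hT3 : (T : ℝ) ≤ (T : ℝ) ^ 3 := le_self_pow₀ hT1 (by norm_num)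
  have hcast : (x : ℝ) ≤ (y : ℝ) * (T : ℝ) := by exact_mod_cast h
  calc (x : ℝ) ≤ (y : ℝ) * (T : ℝ) := hcast
    _ ≤ (y : ℝ) * (T : ℝ) ^ 3 := by gcongr
    _ = 1 * 1 * (y : ℝ) * (T : ℝ) ^ 3 := by ring
    _ ≤ 1 * (N : ℝ) ^ ε * (y : ℝ) * (T : ℝ) ^ 3 := by gcongr

/-- Every factor of `T(E)` is `≥ 1` (a prime of the conductor divides `Δ_min`). -/
theorem one_le_factorization_of_mem_primeFactors_conductorNorm' (W : WeierstrassCurve ℚ)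
    [W.IsElliptic] {p : ℕ} (hp : p ∈ (W.conductorNorm ℤ).primeFactors) :
    1 ≤ (W.minimalDiscriminantNorm ℤ).factorization p := by
  -- verbatim `ManyPrimeValuationProduct.one_le_factorization_of_mem_primeFactors_conductorNorm`
  -- (`Theorems/RibetTakahashiSplitManyPrimeValuationProductCensusConverses.lean`), re-proved to keep
  -- this Sketch's import cone Literature-only
  have hrad : UniqueFactorizationMonoid.radical (W.conductorNorm ℤ) =
      UniqueFactorizationMonoid.radical (W.minimalDiscriminantNorm ℤ) :=
    W.radical_conductorNorm_eq_holds
  have hpf : (W.conductorNorm ℤ).primeFactors = (W.minimalDiscriminantNorm ℤ).primeFactors := by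
    rw [← Nat.primeFactors_radical, hrad, Nat.primeFactors_radical]
  rw [hpf] at hp
  obtain ⟨hpp, hpd, hne⟩ := Nat.mem_primeFactors.mp hp
  exact hpp.factorization_pos_of_dvd hne hpd

/-- **B4 (PLAN B, `C = 1`) — PROVED.** Child 1 at prime type from Takahashi 2.3 (`r ∥ N` form) and
modularity of curves of conductor `N` (`exists_isNewformOf`, for Carayol's `N_{W₀} = N` via
`IsNewformOf.level_eq_conductorNorm_of_exists_isNewformOf'`), plus the route item `FreyModularity`:
`D` minimal (`exists_minimal_datum`); `(W₀, D₀, α)` from `exists_optimal_isogeny_modularDegree_eq`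
(`deg D = m δ₀`, `m = deg α`); Takahashi at `(W₀, M := N/q, r := q, P := D₀)` (minimality clause =
gen 13 A2 `conductorRestrictedMinimal_of_optimal`, setup `nonempty_xiSetup'`, `brandtXi_eq_xi`, and
`a_n(W₀) = a_n(f) = a_n(E)` from the two `isNewformOf` fields): `δ₀ i = ξ j`, `i j = c_q(W₀)`, so
`ξ j² = δ₀ c_q(W₀)`; `PastenShimura2024_lemma_6_8_isogeny_holds` along `α` at `v_q` (both curves
multiplicative at `q`: `hasMultiplicativeReductionAt_primesEquiv_symm_of_dvd_of_not_sq_dvd` from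
`q ∥ N`, `hasMultiplicativeReductionAt_of_isIsogenous`; `factorization_minimalDiscriminantNorm_holds`):
`c_q(W₀) b = a c_q(E)`, `a b ∣ m` (= `valTransport_isogeny`); the arithmetic is `primeToSix_xi_le_of_coordinates`
(`cps ξ ≤ cps (deg D) · c_q(E) ≤ cps (deg D) · T`, each factor of `T` is `≥ 1`:
`ManyPrimeValuationProduct.one_le_factorization_of_mem_primeFactors_conductorNorm`) and `cast_le_of_chain_one`.
The proof is p137891's plumbing (its lines `intro … hδ'`) with the pivot `(W⋆, P⋆) := (W₀, D₀)`, `hNs` from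
`IsNewformOf.level_eq_conductorNorm_of_exists_isNewformOf'`, `hPsmin := hmin₀`; its Kenku block (`h163`, `D₁`,
`stub_smulTransportDeg`, `stub_freyScale`) and `stub_valTransport` are gone. [cite: Takahashi2001, Thm. 2.3] -/
theorem primeComparison_kenkuFree (hT : takahashi2001_thm_2_3_of_coprime)
    (hMod₀ : exists_isNewformOf) (hMod : FreyModularity) : PrimeComparison := by
  intro ε hε
  refine ⟨1, ?_⟩
  intro a b hab h0 N _ hN q hq hq2 hqN _hξ
  -- `N = M q`
  obtain ⟨M, hM⟩ := hqN
  rw [mul_comm] at hM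
  subst hM
  haveI := isElliptic_freyCurve h0
  have hdiv : M * q / q = M := Nat.mul_div_cancel M hq.pos
  have hqN' : q ∣ (freyCurve a b).conductorNorm ℤ := by rw [hN]; exact Dvd.intro_left M rfl
  -- `gcd(M, q) = 1` (the Frey curve is multiplicative at odd bad primes)
  have hcop : M.Coprime q := by
    have h := Summit.ABC.ABC.Theorems.DefiniteRTControlPrime.stub_freyLocal a b hab h0 q hq hq2 hqN'
    rwa [hN, hdiv] at h
  -- the witness: a datum `D` of minimal degree of the Frey model
  obtain ⟨D, -, hDmin⟩ := exists_minimal_datum (hMod a b hab h0 (M * q) hN)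
  refine ⟨D, hDmin, ?_⟩
  -- B2: the optimal quotient `(W₀, D₀)` and a `ℚ`-isogeny `α : W₀ → E` with `deg D = deg α · δ₀`
  obtain ⟨W₀, hW₀, D₀, α, hf₀, h₀, hdegα⟩ := exists_optimal_isogeny_modularDegree_eq D
  haveI := hW₀
  -- Carayol via modularity: `N_{W₀} = N`
  have hN₀ : W₀.conductorNorm ℤ = M * q :=
    (IsNewformOf.level_eq_conductorNorm_of_exists_isNewformOf' (N := M * q) hMod₀ D₀.isNewformOf).symm
  -- the optimal datum is minimal in its class, a fortiori among conductor-`N` curves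
  have hker₀ : D₀.isogenyMap.ker = ⊥ := D₀.isogenyMap_ker_eq_bot_iff.mpr h₀
  have hmin₀ : ∀ (W' : WeierstrassCurve ℚ) [W'.IsElliptic], W'.conductorNorm ℤ = M * q →
      ∀ P' : ModularParametrizationData W' (M * q), P'.f = D₀.f →
        D₀.modularDegree ≤ P'.modularDegree := fun W' _ _ P' hP' =>
    D₀.modularDegree_le_of_isogenyMap_ker_eq_bot hker₀ P' hP'
  -- Takahashi 2.3 at `(W₀, D₀)` in a Brandt setup `S` of type `(M, q)`
  obtain ⟨S⟩ := takahashi2001_thm_2_3_of_coprime.nonempty_xiSetup' (M := M) hq hcop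
  obtain ⟨i, j, hi, hij, -, hδ⟩ := hT W₀ M q hq hcop hN₀ D₀ hmin₀ S
  -- `a(W₀) = a(E)`, and the setup computes `brandtXi`
  have hL : (fun n => W₀.LFunction n) = fun n => (freyCurve a b).LFunction n := by
    funext n
    have h1 := D₀.isNewformOf.2 n
    have h2 := D.isNewformOf.2 n
    rw [hf₀] at h1
    rw [h1] at h2
    exact_mod_cast h2
  have hδ' : D₀.modularDegree * i =
      brandtXi (M * q / q) q (fun n => (freyCurve a b).LFunction n) * j := by
    rw [hdiv, Brandt.XiSetup.brandtXi_eq_xi S, ← hL]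
    exact hδ
  -- Lemma 6.8 along `α` (B4-val): `c_q(W₀) b' = c_q(E) a'`, `a' b' ∣ deg α`
  have hiso : (freyCurve a b).IsIsogenous W₀ := IsIsogenous.symm_of_isElliptic ⟨α⟩
  obtain ⟨a', b', ha', hb', hdvd', h68⟩ := valTransport_isogeny a b hab h0 q hq hq2 hqN' hiso α
  -- `0 < deg α`
  have hm : 0 < α.degree := by
    rcases Nat.eq_zero_or_pos α.degree with h | h
    · rw [h, zero_mul] at hdegα
      exact absurd hdegα D.deg_pos.ne'
    · exact h
  -- every factor of `T` is `≥ 1`, and `c_q(E) ≤ T`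
  have hqmem : q ∈ (M * q).primeFactors :=
    Nat.mem_primeFactors.mpr ⟨hq, Dvd.intro_left M rfl, NeZero.ne _⟩
  have hfac1 : ∀ p ∈ (M * q).primeFactors,
      1 ≤ ((freyCurve a b).minimalDiscriminantNorm ℤ).factorization p := by
    intro p hp
    rw [← hN] at hp
    exact one_le_factorization_of_mem_primeFactors_conductorNorm' (freyCurve a b) hp
  have h1T : 1 ≤ ∏ p ∈ (M * q).primeFactors,
      ((freyCurve a b).minimalDiscriminantNorm ℤ).factorization p :=
    Finset.one_le_prod' hfac1
  have hcE : ((freyCurve a b).minimalDiscriminantNorm ℤ).factorization q ≤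
      ∏ p ∈ (M * q).primeFactors, ((freyCurve a b).minimalDiscriminantNorm ℤ).factorization p :=
    Finset.single_le_prod' hfac1 hqmem
  -- B4-core: `cps ξ ≤ cps (deg D) · c_q(E) ≤ cps (deg D) · T`, then to `ℝ`
  have hcore := primeToSix_xi_le_of_coordinates hi hij hδ' D₀.deg_pos h68 ha' hb' hdvd' hm hdegα
  exact cast_le_of_chain_one hε (NeZero.ne (M * q)) h1T (hcore.trans (Nat.mul_le_mul_left _ hcE))

/-- **PLAN B, two-fact form.** `FreyModularity` is itself a consequence of the named fact
`exists_isNewformOf` (`freyModularity_of_exists_isNewformOf'`, `Theorems/DefiniteXiFreyModularityIsModular.lean`),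
so child 1 at prime type holds with `C = 1` from {Takahashi 2001 Thm 2.3 (`r ∥ N` form), BCDT}. -/
theorem primeComparison_of_takahashi_of_modularity (hT : takahashi2001_thm_2_3_of_coprime)
    (hMod₀ : exists_isNewformOf) : PrimeComparison :=
  primeComparison_kenkuFree hT hMod₀ (Summit.ABC.ABC.Theorems.freyModularity_of_exists_isNewformOf' hMod₀)

/-! ## Part III — typing checks of the tree inputs (no new facts) -/

/-- M1 instantiated on data: the hypotheses of `exists_isogeny_degree_eq_of_isNeronLatticeOf` ARE the
structure fields `isNeronLattice`. -/
example {N : ℕ} [NeZero N] {W W₀ : WeierstrassCurve ℚ} [W₀.IsElliptic]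
    (D : ModularParametrizationData W N) (D₀ : ModularParametrizationData W₀ N) {c : ℚ} (hc : c ≠ 0)
    (hle : ∀ z ∈ D₀.L.lattice, (c : ℂ) * z ∈ D.L.lattice) :
    ∃ φ : Isogeny W₀ W, φ.degree = D₀.L.lattice.toAddSubgroup.relIndex
        (D.L.lattice.toAddSubgroup.comap (AddMonoidHom.mulLeft (c : ℂ))) :=
  exists_isogeny_degree_eq_of_isNeronLatticeOf W₀ W D₀.isNeronLattice D.isNeronLattice hc hle

/-- Lemma 6.8 (isogeny form) is a tree THEOREM. -/
example : PastenShimura2024_lemma_6_8_isogeny := PastenShimura2024_lemma_6_8_isogeny_holds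

/-- Carayol's `N_{W₀} = N` for the curve of ANY datum at level `N`, from `exists_isNewformOf`. -/
example (h₁ : exists_isNewformOf) {N : ℕ} [NeZero N] {W₀ : WeierstrassCurve ℚ} [W₀.IsElliptic]
    (D₀ : ModularParametrizationData W₀ N) : W₀.conductorNorm ℤ = N :=
  (IsNewformOf.level_eq_conductorNorm_of_exists_isNewformOf' (N := N) h₁ D₀.isNewformOf).symm

end Summit.ABC.ABC.Cruxes.SteinbergCore.StubIdeasK1G14

end
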